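import Literature.AlgebraicGeometry.HodgeTheory.AbelianVarietyCentralIdempotentImages
import Literature.AlgebraicGeometry.Motives.FaltingsAbelianOfFinitenessIProofs
import Literature.AlgebraicGeometry.Motives.AbelianVarietyPoincarePerfectField
import HarnessLib

/-!
# Which idempotents of `End⁰(X)` have an `End X`-stable image: `A^{z}` is stable iff `(1 - z) End⁰(X) z = 0` iff (over a
# perfect field) `z` is central; an abelian subvariety is the image of exactly one idempotent when it is `End X`-stable and
# of infinitely many otherwise (Lam §21 (21.5), §22 (22.1); Lange–Rodríguez §2.9; Mumford §19 Cor. 2)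

Layer `Literature/AlgebraicGeometry/HodgeTheory`; theorems only (no `def`, no instance, no named fact; net debt 0).  Sequel of
`HodgeTheory/AbelianVarietyCentralIdempotentImages` (`z ↦ A^{z} = u(X)` for `d z = 1 ⊗ u` is a bijection from the CENTRAL
idempotents of `End⁰ X` onto the `End X`-stable abelian subvarieties).  Here the fibres of `z ↦ A^{z}` on ALL idempotents.
§0 (rings): a semisimple ring is semiprime (`x R x = 0 ⟹ x = 0`), so for an idempotent `e` the two corner conditions
`(1 - e) R e = 0` and `e R (1 - e) = 0` are equivalent, and either one is equivalent to `e` being central (Lam (21.5)); an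
idempotent `e` with `e a (1 - e) ≠ 0` starts the affine line `e + t · e a (1 - e)` (`t ∈ ℚ`) of pairwise distinct idempotents `e'`
with `e' e = e`, `e e' = e'`.  §1 (any field): for an idempotent `z ∈ End⁰ X` with `d z = 1 ⊗ u`:
**`A^{z}` is `End X`-stable iff `(1 - z) a z = 0` for all `a ∈ End⁰ X`** (`ψ(u(X)) ⊆ u(X)` iff `(d - u) ψ u = 0`); `z` is central
iff BOTH `A^{z}` and its complement `A^{1-z} = (d - u)(X)` are `End X`-stable; idempotents `z'` with `z' z = z`, `z z' = z'` have
`A^{z'} = A^{z}`, so `z R (1 - z) ≠ 0` produces infinitely many idempotents with the image `A^{z}`, while a central `z` is the only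
idempotent with its image.  §2 (perfect field; `End⁰ X` semisimple, the tree's `isSemisimpleRing_endAlgebra_of_perfectField`):
`A^{z}` is `End X`-stable iff `z` is central iff `A^{1-z}` is `End X`-stable; the set of idempotents with image `A^{z}` is `{z}` when
`A^{z}` is `End X`-stable and INFINITE otherwise; every abelian subvariety `Z ↪ X` is some `A^{z}` (a quasi-retraction
`i ≫ h = N • 𝟙`, Poincaré), so **an abelian subvariety is the image of exactly one idempotent of `End⁰ X` if it is `End X`-stable,
and of infinitely many otherwise**.

THE PRINT.  Lam, *A First Course in Noncommutative Rings* §21 Lemma (21.5) (p. 308: `e` central iff `eR(1-e) = (1-e)Re = 0`),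
§22 Prop. (22.1) (p. 326), §10 (semisimple rings are semiprime, (10.16)–(10.17), p. 166); Lange–Rodríguez, *Decomposition of
Jacobians by Prym Varieties* §2.9 (PDF p. 43: `A^{e} := Im(m e)`, «the e_i are uniquely determined»); Mumford §19 Cor. 2 of
Thm. 1 (p. 174: `End⁰ X` semisimple) and Thm. 3 (p. 176); Milne 1986 Prop. 12.1 (p. 122: quasi-complements).

Results (namespace `Literature.AlgebraicGeometry.HodgeTheory.AbelianVariety`):
* §0 (rings) `eq_zero_of_forall_mul_mul_self_eq_zero` (semisimple ⟹ semiprime),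
  **`mul_mul_one_sub_eq_zero_of_one_sub_mul_mul_eq_zero`** ∕ `one_sub_mul_mul_eq_zero_of_mul_mul_one_sub_eq_zero` (the two
  corners of an idempotent of a semisimple ring vanish together), **`forall_comm_iff_one_sub_mul_mul_eq_zero`**,
  `forall_comm_iff_mul_mul_one_sub_eq_zero`, `isIdempotentElem_add_of_mul_eq`, `add_mul_eq_of_mul_eq`, `mul_add_eq_of_mul_eq`,
  `infinite_setOf_isIdempotentElem_mul_eq_of_ne_zero` (the affine line `e + t · e a (1 - e)` of idempotents);
* §1 (any field) `algebraMap_mul_one_sub_eq_of`, `range_subset_range_of_mul_eq`, **`range_eq_range_of_mul_eq_of_mul_eq`**,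
  **`forall_range_comp_subset_iff_forall_one_sub_mul_mul_eq_zero`** (`A^{z}` stable iff `(1 - z) End⁰X z = 0`),
  **`forall_comm_iff_forall_range_comp_subset_and_compl`** (`z` central iff `A^{z}` and `A^{1-z}` are both stable),
  `eq_of_isIdempotentElem_of_forall_comm_of_range_eq` (a central idempotent is the only idempotent with its image),
  **`infinite_setOf_isIdempotentElem_range_eq_of_ne_zero`** (`z a (1 - z) ≠ 0` ⟹ infinitely many idempotents with image `A^{z}`);
* §2 (perfect field, every `X`) **`forall_range_comp_subset_iff_forall_comm`** (`A^{z}` stable iff `z` central),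
  `forall_range_comp_subset_iff_compl`, **`setOf_isIdempotentElem_range_eq_eq_singleton_iff`**,
  **`infinite_setOf_isIdempotentElem_range_eq_iff`**, `exists_isIdempotentElem_range_eq_subvariety` (every abelian subvariety is an `A^{z}`),
  **`setOf_isIdempotentElem_range_eq_subvariety_eq_singleton_or_infinite`** (an abelian subvariety is the image of exactly one
  idempotent iff it is `End X`-stable, of infinitely many otherwise).

## References
* [Lam2001FirstCourse] T. Y. Lam, *A First Course in Noncommutative Rings*, 2nd ed. (2001), §10 (10.16)–(10.17) p. 166, §21
  Lemma (21.5) p. 308, §22 Prop. (22.1) p. 326.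
* [LangeRodriguez2022] H. Lange, R. E. Rodríguez, *Decomposition of Jacobians by Prym Varieties*, LNM 2310 (2022), §2.9 (PDF p. 43).
* [MumfordAV1970] D. Mumford, *Abelian Varieties* (1970), §19 Thm. 1, Cor. 2, Thm. 3 (pp. 173–176).
* [Milne1986AbelianVarieties] J. S. Milne, *Abelian Varieties*, in Cornell–Silverman (1986), Prop. 12.1 and §12 p. 122.
-/

noncomputable section

universe u

open CategoryTheory CategoryTheory.Limits

namespace Literature.AlgebraicGeometry.HodgeTheory

namespace AbelianVariety

open _root_.AlgebraicGeometry
open Literature.AlgebraicGeometry.Motives Literature.AlgebraicGeometry.Motives.AbelianVariety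

/-! ## §0 Ring theory: corners of idempotents in a semisimple ring -/

section Ring

variable {R : Type*} [Ring R]

/-- **A semisimple ring is semiprime**: `x a x = 0` for all `a` forces `x = 0` (the left ideal `R x` has a complement `L`,
`1 = r x + l`, and `x = x r x + x l = x l ∈ R x ∩ L = 0`). [cite: Lam2001FirstCourse, §10 (10.16)–(10.17), p. 166] -/
theorem eq_zero_of_forall_mul_mul_self_eq_zero [IsSemisimpleRing R] {x : R} (h : ∀ a, x * a * x = 0) : x = 0 := by
  obtain ⟨L, hL⟩ := exists_isCompl (Submodule.span R ({x} : Set R))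
  have h1 : (1 : R) ∈ Submodule.span R ({x} : Set R) ⊔ L := by rw [hL.sup_eq_top]; exact Submodule.mem_top
  obtain ⟨y, hy, l, hl, hyl⟩ := Submodule.mem_sup.1 h1
  obtain ⟨r, rfl⟩ := Submodule.mem_span_singleton.1 hy
  have hx : x = x * l := by
    have h2 := congrArg (x * ·) hyl
    simp only [mul_add, mul_one, smul_eq_mul, ← mul_assoc, h r, zero_add] at h2
    exact h2.symm
  have hmem : x ∈ Submodule.span R ({x} : Set R) ⊓ L :=
    ⟨Submodule.mem_span_singleton_self x, by rw [hx]; exact L.smul_mem x hl⟩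
  rw [hL.inf_eq_bot, Submodule.mem_bot] at hmem
  exact hmem

/-- **The two corners vanish together**: for an idempotent `e` of a semisimple ring, `(1 - e) R e = 0` implies `e R (1 - e) = 0`
(`x = e a (1 - e)` has `x R x ⊆ e a ((1 - e) R e) a (1 - e) = 0`). [cite: Lam2001FirstCourse, §21 Lemma (21.5) p. 308 and §10 (10.16) p. 166] -/
theorem mul_mul_one_sub_eq_zero_of_one_sub_mul_mul_eq_zero [IsSemisimpleRing R] {e : R} (h : ∀ a, (1 - e) * a * e = 0)
    (a : R) : e * a * (1 - e) = 0 := by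
  refine eq_zero_of_forall_mul_mul_self_eq_zero fun b ↦ ?_
  rw [show e * a * (1 - e) * b * (e * a * (1 - e)) = e * a * ((1 - e) * b * e) * (a * (1 - e)) by simp only [mul_assoc],
    h, mul_zero, zero_mul]

/-- Symmetrically, `e R (1 - e) = 0` implies `(1 - e) R e = 0` (semisimple ring). [cite: Lam2001FirstCourse, §21 Lemma (21.5) p. 308] -/
theorem one_sub_mul_mul_eq_zero_of_mul_mul_one_sub_eq_zero [IsSemisimpleRing R] {e : R} (h : ∀ a, e * a * (1 - e) = 0)
    (a : R) : (1 - e) * a * e = 0 := by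
  have h' := mul_mul_one_sub_eq_zero_of_one_sub_mul_mul_eq_zero (e := 1 - e) (fun b ↦ by rw [sub_sub_cancel]; exact h b) a
  rwa [sub_sub_cancel] at h'

/-- **In a semisimple ring an idempotent `e` is central iff `(1 - e) a e = 0` for all `a`** (one corner suffices).
[cite: Lam2001FirstCourse, §21 Lemma (21.5) p. 308 and §22 Prop. (22.1) p. 326] -/
theorem forall_comm_iff_one_sub_mul_mul_eq_zero [IsSemisimpleRing R] {e : R} (he : IsIdempotentElem e) :
    (∀ a, e * a = a * e) ↔ ∀ a, (1 - e) * a * e = 0 := by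
  rw [Literature.RingTheory.Idempotents.forall_comm_iff_corner_eq_zero he]
  exact ⟨fun h a ↦ (h a).2, fun h a ↦ ⟨mul_mul_one_sub_eq_zero_of_one_sub_mul_mul_eq_zero h a, h a⟩⟩

/-- In a semisimple ring an idempotent `e` is central iff `e a (1 - e) = 0` for all `a`. [cite: Lam2001FirstCourse, §21 Lemma (21.5) p. 308] -/
theorem forall_comm_iff_mul_mul_one_sub_eq_zero [IsSemisimpleRing R] {e : R} (he : IsIdempotentElem e) :
    (∀ a, e * a = a * e) ↔ ∀ a, e * a * (1 - e) = 0 := by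
  rw [forall_comm_iff_one_sub_mul_mul_eq_zero he]
  exact ⟨mul_mul_one_sub_eq_zero_of_one_sub_mul_mul_eq_zero, one_sub_mul_mul_eq_zero_of_mul_mul_one_sub_eq_zero⟩

/-- `e + w` is idempotent when `e` is, `e w = w` and `w e = 0` (e.g. `w = e a (1 - e)`). [cite: Lam2001FirstCourse, §21 (Peirce decomposition, p. 308)] -/
theorem isIdempotentElem_add_of_mul_eq {e w : R} (he : IsIdempotentElem e) (hew : e * w = w) (hwe : w * e = 0) :
    IsIdempotentElem (e + w) := by
  have hww : w * w = 0 := by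
    calc w * w = w * (e * w) := by rw [hew]
      _ = w * e * w := (mul_assoc _ _ _).symm
      _ = 0 := by rw [hwe, zero_mul]
  unfold IsIdempotentElem
  rw [add_mul, mul_add, mul_add, he.eq, hew, hwe, hww, add_zero, add_zero]

/-- `(e + w) e = e` when `e² = e`, `w e = 0`. [cite: Lam2001FirstCourse, §21 (p. 308)] -/
theorem add_mul_eq_of_mul_eq {e w : R} (he : IsIdempotentElem e) (hwe : w * e = 0) : (e + w) * e = e := by
  rw [add_mul, he.eq, hwe, add_zero]

/-- `e (e + w) = e + w` when `e² = e`, `e w = w`. [cite: Lam2001FirstCourse, §21 (p. 308)] -/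
theorem mul_add_eq_of_mul_eq {e w : R} (he : IsIdempotentElem e) (hew : e * w = w) : e * (e + w) = e + w := by
  rw [mul_add, he.eq, hew]

/-- **`e a (1 - e) ≠ 0` starts an affine line of idempotents `e_t = e + t · e a (1 - e)` (`t ∈ ℚ`) with `e_t e = e`, `e e_t = e_t`**,
pairwise distinct (a `ℚ`-algebra). [cite: Lam2001FirstCourse, §21 Lemma (21.5) p. 308] -/
theorem infinite_setOf_isIdempotentElem_mul_eq_of_ne_zero {E : Type*} [Ring E] [Algebra ℚ E] {e a : E} (he : IsIdempotentElem e)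
    (ha : e * a * (1 - e) ≠ 0) : {e' : E | IsIdempotentElem e' ∧ e' * e = e ∧ e * e' = e'}.Infinite := by
  set w : E := e * a * (1 - e) with hw
  have hew : e * w = w := by rw [hw, ← mul_assoc, ← mul_assoc, he.eq]
  have hwe : w * e = 0 := by rw [hw, mul_assoc, sub_mul, one_mul, he.eq, sub_self, mul_zero]
  refine Set.infinite_of_injective_forall_mem (f := fun t : ℚ ↦ e + t • w)
    (fun s t hst ↦ smul_left_injective ℚ ha (add_left_cancel hst)) fun t ↦ ?_
  have htw : e * (t • w) = t • w := by rw [mul_smul_comm, hew]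
  have hwt : (t • w) * e = 0 := by rw [smul_mul_assoc, hwe, smul_zero]
  exact ⟨isIdempotentElem_add_of_mul_eq he htw hwt, add_mul_eq_of_mul_eq he hwt, mul_add_eq_of_mul_eq he htw⟩

/-- Clearing three rational denominators: `(r x) (s a) (t z) = 0` with `r, s, t ≠ 0` gives `x a z = 0`. [folklore] -/
private theorem mul_mul_eq_zero_of_algebraMap_mul [Algebra ℚ R] {r s t : ℚ} (hr : r ≠ 0) (hs : s ≠ 0) (ht : t ≠ 0)
    {x a z : R} (h : algebraMap ℚ R r * x * (algebraMap ℚ R s * a) * (algebraMap ℚ R t * z) = 0) : x * a * z = 0 := by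
  simp only [← Algebra.smul_def, smul_mul_assoc, mul_smul_comm, smul_smul] at h
  rw [smul_eq_zero] at h
  rcases h with h | h
  · simp [hr, hs, ht] at h
  · simpa only [mul_assoc] using h

end Ring

variable {K : Type u} [Field K]

/-! ## §1 Stability of the image `A^{z}` (any field) -/

section AnyField

variable {X : Motives.AbelianVariety K} {z : X.endAlgebra} {d : ℕ} {u : X ⟶ X}

/-- The complementary quasi-idempotent: `d (1 - z) = 1 ⊗ (d - u)` when `d z = 1 ⊗ u`. [cite: LangeRodriguez2022, §2.9 (PDF p. 43)] -/
theorem algebraMap_mul_one_sub_eq_of (hz : algebraMap ℚ X.endAlgebra (d : ℚ) * z = endAlgebra.of X (End.of u)) :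
    algebraMap ℚ X.endAlgebra (d : ℚ) * (1 - z) = endAlgebra.of X (End.of (d • 𝟙 X - u)) := by
  rw [mul_sub, mul_one, hz, show End.of (d • 𝟙 X - u) = d • (1 : End X) - End.of u from rfl, map_sub, map_nsmul, map_one,
    Algebra.algebraMap_eq_smul_one, Nat.cast_smul_eq_nsmul]

/-- `z' z = z` (integral multiples `d z = 1 ⊗ u`, `d' z' = 1 ⊗ u'`) gives `u ≫ u' = d' • u`, hence `u(X) ⊆ u'(X)`.
[cite: LangeRodriguez2022, §2.9 (PDF p. 43)] [cite: MumfordAV1970, §19 Thm. 3 (p. 176)] -/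
theorem range_subset_range_of_mul_eq (hz : algebraMap ℚ X.endAlgebra (d : ℚ) * z = endAlgebra.of X (End.of u))
    {z' : X.endAlgebra} {d' : ℕ} {u' : X ⟶ X} (hd' : d' ≠ 0)
    (hz' : algebraMap ℚ X.endAlgebra (d' : ℚ) * z' = endAlgebra.of X (End.of u')) (h : z' * z = z) :
    Set.range (Hom.toSchemeHom u) ⊆ Set.range (Hom.toSchemeHom u') := by
  have h1 : endAlgebra.of X (End.of u' * End.of u) = endAlgebra.of X (d' • End.of u) := by
    rw [map_mul, map_nsmul, ← hz']
    conv_lhs => rw [← hz]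
    rw [mul_assoc, Algebra.left_comm, h, hz, ← Algebra.smul_def, Nat.cast_smul_eq_nsmul]
  have h2 := endAlgebra.of_injective_of_isIsogeny_zsmul_id (isIsogeny_zsmul_id_holds X) h1
  rw [End.mul_def] at h2
  exact range_subset_of_comp_eq_nsmul hd' h2

/-- **`z' z = z` and `z z' = z'` give `A^{z'} = A^{z}`.** [cite: LangeRodriguez2022, §2.9 (PDF p. 43)] -/
theorem range_eq_range_of_mul_eq_of_mul_eq (hd : d ≠ 0) (hz : algebraMap ℚ X.endAlgebra (d : ℚ) * z = endAlgebra.of X (End.of u))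
    {z' : X.endAlgebra} {d' : ℕ} {u' : X ⟶ X} (hd' : d' ≠ 0)
    (hz' : algebraMap ℚ X.endAlgebra (d' : ℚ) * z' = endAlgebra.of X (End.of u')) (h₁ : z' * z = z) (h₂ : z * z' = z') :
    Set.range (Hom.toSchemeHom u') = Set.range (Hom.toSchemeHom u) :=
  (range_subset_range_of_mul_eq hz' hd hz h₂).antisymm (range_subset_range_of_mul_eq hz hd' hz' h₁)

/-- The scaled corner `(d (1 - z)) (1 ⊗ ψ) (d z) = 1 ⊗ (d (u ψ) - u ψ u)` (composition written as in `End X`).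
[cite: MumfordAV1970, §19 Thm. 3 (p. 176)] -/
private theorem scaled_corner_eq (hz : algebraMap ℚ X.endAlgebra (d : ℚ) * z = endAlgebra.of X (End.of u)) (ψ : X ⟶ X) :
    algebraMap ℚ X.endAlgebra (d : ℚ) * (1 - z) * endAlgebra.of X (End.of ψ) * (algebraMap ℚ X.endAlgebra (d : ℚ) * z) =
      endAlgebra.of X (d • End.of (u ≫ ψ)) - endAlgebra.of X (End.of (u ≫ ψ ≫ u)) := by
  rw [mul_sub, mul_one, hz, sub_mul, sub_mul, mul_assoc (algebraMap ℚ X.endAlgebra (d : ℚ)), ← map_mul, ← Algebra.smul_def,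
    Nat.cast_smul_eq_nsmul, ← map_nsmul, ← map_mul, ← map_mul]
  rfl

/-- **`A^{z}` IS `End X`-STABLE IFF `(1 - z) End⁰(X) z = 0`** (any field; `z` idempotent, `d z = 1 ⊗ u`, `d ≥ 1`): `ψ(u(X)) ⊆ u(X)`
iff `(d - u) ψ u = 0` in `End X`. [cite: Lam2001FirstCourse, §21 Lemma (21.5) p. 308] [cite: LangeRodriguez2022, §2.9 Thm. 2.9.1 (a) (PDF p. 43)] -/
theorem forall_range_comp_subset_iff_forall_one_sub_mul_mul_eq_zero (hzi : IsIdempotentElem z) (hd : d ≠ 0)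
    (hz : algebraMap ℚ X.endAlgebra (d : ℚ) * z = endAlgebra.of X (End.of u)) :
    (∀ ψ : X ⟶ X, Set.range (Hom.toSchemeHom (u ≫ ψ)) ⊆ Set.range (Hom.toSchemeHom u)) ↔ ∀ a, (1 - z) * a * z = 0 := by
  have hinj := endAlgebra.of_injective_of_isIsogeny_zsmul_id (isIsogeny_zsmul_id_holds X)
  have hu := comp_self_eq_nsmul_of_isIdempotentElem hzi hz
  have hd' : (d : ℚ) ≠ 0 := Nat.cast_ne_zero.2 hd
  constructor
  · intro hstab a
    obtain ⟨D, ψ, hD, ha⟩ := exists_algebraMap_mul_eq_of a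
    have h0 : (u ≫ ψ) ≫ (d • 𝟙 X - u) = 0 := comp_eq_zero_of_range_subset u (comp_nsmul_id_sub_eq_zero hu) (hstab ψ)
    have h1 : d • (u ≫ ψ) = u ≫ ψ ≫ u := by
      rwa [Preadditive.comp_sub, Preadditive.comp_nsmul, Category.comp_id, Category.assoc, sub_eq_zero] at h0
    refine mul_mul_eq_zero_of_algebraMap_mul hd' (Nat.cast_ne_zero.2 hD) hd' ?_
    rw [ha, scaled_corner_eq hz ψ, sub_eq_zero]
    exact congrArg (endAlgebra.of X) h1
  · intro h ψ
    have h1 : algebraMap ℚ X.endAlgebra (d : ℚ) * (1 - z) * endAlgebra.of X (End.of ψ) *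
        (algebraMap ℚ X.endAlgebra (d : ℚ) * z) = 0 := by
      rw [mul_assoc (algebraMap ℚ X.endAlgebra (d : ℚ)) (1 - z), mul_assoc (algebraMap ℚ X.endAlgebra (d : ℚ)),
        Algebra.left_comm ((1 - z) * endAlgebra.of X (End.of ψ)), h, mul_zero, mul_zero]
    rw [scaled_corner_eq hz ψ, sub_eq_zero] at h1
    have h2 : d • (u ≫ ψ) = u ≫ ψ ≫ u := hinj h1
    rw [← range_toSchemeHom_nsmul hd (u ≫ ψ), h2, ← Category.assoc]
    exact range_toSchemeHom_comp_subset _ _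

/-- **`z` IS CENTRAL IFF BOTH `A^{z}` AND ITS COMPLEMENT `A^{1-z} = (d - u)(X)` ARE `End X`-STABLE** (any field).
[cite: Lam2001FirstCourse, §21 Lemma (21.5) p. 308] [cite: LangeRodriguez2022, §2.9 Thm. 2.9.1 (a) (PDF p. 43)] -/
theorem forall_comm_iff_forall_range_comp_subset_and_compl (hzi : IsIdempotentElem z) (hd : d ≠ 0)
    (hz : algebraMap ℚ X.endAlgebra (d : ℚ) * z = endAlgebra.of X (End.of u)) :
    (∀ a, z * a = a * z) ↔
      (∀ ψ : X ⟶ X, Set.range (Hom.toSchemeHom (u ≫ ψ)) ⊆ Set.range (Hom.toSchemeHom u)) ∧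
        ∀ ψ : X ⟶ X, Set.range (Hom.toSchemeHom ((d • 𝟙 X - u) ≫ ψ)) ⊆ Set.range (Hom.toSchemeHom (d • 𝟙 X - u)) := by
  rw [forall_range_comp_subset_iff_forall_one_sub_mul_mul_eq_zero hzi hd hz,
    forall_range_comp_subset_iff_forall_one_sub_mul_mul_eq_zero hzi.one_sub hd (algebraMap_mul_one_sub_eq_of hz), sub_sub_cancel,
    Literature.RingTheory.Idempotents.forall_comm_iff_corner_eq_zero hzi]
  exact ⟨fun h ↦ ⟨fun a ↦ (h a).2, fun a ↦ (h a).1⟩, fun h a ↦ ⟨h.2 a, h.1 a⟩⟩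

/-- **A CENTRAL IDEMPOTENT IS THE ONLY IDEMPOTENT WITH ITS IMAGE** (any field): `z' z = ?` is not needed — a central `z` commutes
with `z'`, and commuting idempotents with the same image coincide. [cite: LangeRodriguez2022, §2.9 (PDF p. 43: «the e_i are uniquely determined»)] -/
theorem eq_of_isIdempotentElem_of_forall_comm_of_range_eq (hzi : IsIdempotentElem z) (hc : ∀ a, z * a = a * z) (hd : d ≠ 0)
    (hz : algebraMap ℚ X.endAlgebra (d : ℚ) * z = endAlgebra.of X (End.of u)) {z' : X.endAlgebra} (hz'i : IsIdempotentElem z')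
    {d' : ℕ} {u' : X ⟶ X} (hd' : d' ≠ 0) (hz' : algebraMap ℚ X.endAlgebra (d' : ℚ) * z' = endAlgebra.of X (End.of u'))
    (h : Set.range (Hom.toSchemeHom u') = Set.range (Hom.toSchemeHom u)) : z' = z :=
  eq_of_isIdempotentElem_of_commute_of_range_eq hz'i hzi (hc z').symm hd' hz' hd hz h

/-- **`z a (1 - z) ≠ 0` PRODUCES INFINITELY MANY IDEMPOTENTS WITH THE IMAGE `A^{z}`** (any field): the idempotents
`z_t = z + t · z a (1 - z)` (`t ∈ ℚ`) are pairwise distinct and `z_t z = z`, `z z_t = z_t`.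
[cite: Lam2001FirstCourse, §21 Lemma (21.5) p. 308] [cite: LangeRodriguez2022, §2.9 (PDF p. 43)] -/
theorem infinite_setOf_isIdempotentElem_range_eq_of_ne_zero (hzi : IsIdempotentElem z) (hd : d ≠ 0)
    (hz : algebraMap ℚ X.endAlgebra (d : ℚ) * z = endAlgebra.of X (End.of u)) {a : X.endAlgebra} (ha : z * a * (1 - z) ≠ 0) :
    {z' : X.endAlgebra | IsIdempotentElem z' ∧ ∃ (d' : ℕ) (u' : X ⟶ X), d' ≠ 0 ∧
      algebraMap ℚ X.endAlgebra (d' : ℚ) * z' = endAlgebra.of X (End.of u') ∧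
        Set.range (Hom.toSchemeHom u') = Set.range (Hom.toSchemeHom u)}.Infinite := by
  refine (infinite_setOf_isIdempotentElem_mul_eq_of_ne_zero hzi ha).mono ?_
  rintro z' ⟨hz'i, h₁, h₂⟩
  obtain ⟨d', u', hd', hu'⟩ := exists_algebraMap_mul_eq_of z'
  exact ⟨hz'i, d', u', hd', hu', range_eq_range_of_mul_eq_of_mul_eq hd hz hd' hu' h₁ h₂⟩

end AnyField

/-! ## §2 Over a perfect field: stable iff central; one idempotent or infinitely many -/

section Perfect

variable [PerfectField K] {X : Motives.AbelianVariety K} {z : X.endAlgebra} {d : ℕ} {u : X ⟶ X}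

/-- **`A^{z}` IS `End X`-STABLE IFF `z` IS CENTRAL** (every abelian variety over a perfect field; `End⁰ X` is semisimple).
[cite: Lam2001FirstCourse, §21 Lemma (21.5) p. 308] [cite: MumfordAV1970, §19 Cor. 2 of Thm. 1 (p. 174)] [cite: LangeRodriguez2022, §2.9 (PDF p. 43)] -/
theorem forall_range_comp_subset_iff_forall_comm (hzi : IsIdempotentElem z) (hd : d ≠ 0)
    (hz : algebraMap ℚ X.endAlgebra (d : ℚ) * z = endAlgebra.of X (End.of u)) :
    (∀ ψ : X ⟶ X, Set.range (Hom.toSchemeHom (u ≫ ψ)) ⊆ Set.range (Hom.toSchemeHom u)) ↔ ∀ a, z * a = a * z := by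
  haveI := isSemisimpleRing_endAlgebra_of_perfectField X
  rw [forall_range_comp_subset_iff_forall_one_sub_mul_mul_eq_zero hzi hd hz, forall_comm_iff_one_sub_mul_mul_eq_zero hzi]

/-- **`A^{z}` is `End X`-stable iff its complement `A^{1-z} = (d - u)(X)` is** (perfect field). [cite: Lam2001FirstCourse, §21 Lemma (21.5) p. 308]
[cite: MumfordAV1970, §19 Cor. 2 of Thm. 1 (p. 174)] -/
theorem forall_range_comp_subset_iff_compl (hzi : IsIdempotentElem z) (hd : d ≠ 0)
    (hz : algebraMap ℚ X.endAlgebra (d : ℚ) * z = endAlgebra.of X (End.of u)) :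
    (∀ ψ : X ⟶ X, Set.range (Hom.toSchemeHom (u ≫ ψ)) ⊆ Set.range (Hom.toSchemeHom u)) ↔
      ∀ ψ : X ⟶ X, Set.range (Hom.toSchemeHom ((d • 𝟙 X - u) ≫ ψ)) ⊆ Set.range (Hom.toSchemeHom (d • 𝟙 X - u)) := by
  rw [forall_range_comp_subset_iff_forall_comm hzi hd hz,
    forall_range_comp_subset_iff_forall_comm hzi.one_sub hd (algebraMap_mul_one_sub_eq_of hz)]
  constructor
  · intro h a
    rw [sub_mul, mul_sub, one_mul, mul_one, h a]
  · intro h a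
    have := h a
    rw [sub_mul, mul_sub, one_mul, mul_one] at this
    exact sub_right_injective this

/-- **THE IDEMPOTENTS WITH IMAGE `A^{z}` FORM THE SINGLETON `{z}` IFF `A^{z}` IS `End X`-STABLE** (perfect field).
[cite: LangeRodriguez2022, §2.9 (PDF p. 43)] [cite: Lam2001FirstCourse, §21 Lemma (21.5) p. 308 and §22 Prop. (22.1) p. 326] -/
theorem setOf_isIdempotentElem_range_eq_eq_singleton_iff (hzi : IsIdempotentElem z) (hd : d ≠ 0)
    (hz : algebraMap ℚ X.endAlgebra (d : ℚ) * z = endAlgebra.of X (End.of u)) :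
    {z' : X.endAlgebra | IsIdempotentElem z' ∧ ∃ (d' : ℕ) (u' : X ⟶ X), d' ≠ 0 ∧
      algebraMap ℚ X.endAlgebra (d' : ℚ) * z' = endAlgebra.of X (End.of u') ∧
        Set.range (Hom.toSchemeHom u') = Set.range (Hom.toSchemeHom u)} = {z} ↔
      ∀ ψ : X ⟶ X, Set.range (Hom.toSchemeHom (u ≫ ψ)) ⊆ Set.range (Hom.toSchemeHom u) := by
  haveI := isSemisimpleRing_endAlgebra_of_perfectField X
  constructor
  · intro h
    by_contra hns
    have hnc : ¬ ∀ a, z * a = a * z := fun hc ↦ hns ((forall_range_comp_subset_iff_forall_comm hzi hd hz).2 hc)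
    rw [forall_comm_iff_mul_mul_one_sub_eq_zero hzi, not_forall] at hnc
    obtain ⟨a, ha⟩ := hnc
    exact (infinite_setOf_isIdempotentElem_range_eq_of_ne_zero hzi hd hz ha) (by rw [h]; exact Set.finite_singleton z)
  · intro hstab
    have hc := (forall_range_comp_subset_iff_forall_comm hzi hd hz).1 hstab
    refine Set.eq_singleton_iff_unique_mem.2 ⟨⟨hzi, d, u, hd, hz, rfl⟩, fun z' ⟨hz'i, d', u', hd', hz', h⟩ ↦ ?_⟩
    exact eq_of_isIdempotentElem_of_forall_comm_of_range_eq hzi hc hd hz hz'i hd' hz' h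

/-- **… AND ARE INFINITE IN NUMBER IFF `A^{z}` IS NOT `End X`-STABLE** (perfect field). [cite: LangeRodriguez2022, §2.9 (PDF p. 43)]
[cite: Lam2001FirstCourse, §21 Lemma (21.5) p. 308] -/
theorem infinite_setOf_isIdempotentElem_range_eq_iff (hzi : IsIdempotentElem z) (hd : d ≠ 0)
    (hz : algebraMap ℚ X.endAlgebra (d : ℚ) * z = endAlgebra.of X (End.of u)) :
    {z' : X.endAlgebra | IsIdempotentElem z' ∧ ∃ (d' : ℕ) (u' : X ⟶ X), d' ≠ 0 ∧
      algebraMap ℚ X.endAlgebra (d' : ℚ) * z' = endAlgebra.of X (End.of u') ∧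
        Set.range (Hom.toSchemeHom u') = Set.range (Hom.toSchemeHom u)}.Infinite ↔
      ¬ ∀ ψ : X ⟶ X, Set.range (Hom.toSchemeHom (u ≫ ψ)) ⊆ Set.range (Hom.toSchemeHom u) := by
  haveI := isSemisimpleRing_endAlgebra_of_perfectField X
  constructor
  · intro h hstab
    exact h (by rw [(setOf_isIdempotentElem_range_eq_eq_singleton_iff hzi hd hz).2 hstab]; exact Set.finite_singleton z)
  · intro hns
    have hnc : ¬ ∀ a, z * a = a * z := fun hc ↦ hns ((forall_range_comp_subset_iff_forall_comm hzi hd hz).2 hc)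
    rw [forall_comm_iff_mul_mul_one_sub_eq_zero hzi, not_forall] at hnc
    obtain ⟨a, ha⟩ := hnc
    exact infinite_setOf_isIdempotentElem_range_eq_of_ne_zero hzi hd hz ha

/-- **EVERY ABELIAN SUBVARIETY IS THE IMAGE `A^{z}` OF AN IDEMPOTENT OF `End⁰ X`** (perfect field): a quasi-retraction `i ≫ h = N • 𝟙`
(Poincaré) gives the quasi-idempotent `u = h ≫ i`, `u ≫ u = N • u`, `u(X) = i(Z)`, and `z = N⁻¹ (1 ⊗ u)`.
[cite: Milne1986AbelianVarieties, Prop. 12.1 (p. 122)] [cite: LangeRodriguez2022, §2.9 (PDF p. 43)] [cite: MumfordAV1970, §19 Thm. 1 (p. 173)] -/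
theorem exists_isIdempotentElem_range_eq_subvariety {Z : Motives.AbelianVariety K} (i : Z ⟶ X) [IsClosedImmersion (Hom.toSchemeHom i)] :
    ∃ (z : X.endAlgebra) (d : ℕ) (u : X ⟶ X), IsIdempotentElem z ∧ d ≠ 0 ∧
      algebraMap ℚ X.endAlgebra (d : ℚ) * z = endAlgebra.of X (End.of u) ∧
        Set.range (Hom.toSchemeHom u) = Set.range (Hom.toSchemeHom i) := by
  obtain ⟨h, N, hN, hih⟩ := exists_quasiRetraction_of_perfectField i
  have hN' : (N : ℚ) ≠ 0 := Nat.cast_ne_zero.2 hN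
  haveI : Surjective (Hom.toSchemeHom h) := surjective_of_comp_eq_nsmul_id hN hih
  refine ⟨algebraMap ℚ X.endAlgebra (N : ℚ)⁻¹ * endAlgebra.of X (End.of (h ≫ i)), N, h ≫ i, ?_, hN, ?_,
    range_toSchemeHom_comp_eq_of_surjective h i⟩
  · have huu : End.of (h ≫ i) * End.of (h ≫ i) = N • End.of (h ≫ i) := by
      rw [End.mul_def]
      change (h ≫ i) ≫ h ≫ i = N • (h ≫ i)
      rw [Category.assoc, ← Category.assoc i h i, hih, Preadditive.nsmul_comp, Category.id_comp, Preadditive.comp_nsmul]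
    rw [IsIdempotentElem, mul_assoc, Algebra.left_comm, ← map_mul, huu, map_nsmul, nsmul_eq_mul,
      ← map_natCast (algebraMap ℚ X.endAlgebra) N, ← mul_assoc, ← mul_assoc, ← map_mul, ← map_mul,
      show (N : ℚ)⁻¹ * (N : ℚ)⁻¹ * (N : ℚ) = (N : ℚ)⁻¹ by rw [mul_assoc, inv_mul_cancel₀ hN', mul_one]]
  · rw [← mul_assoc, ← map_mul, mul_inv_cancel₀ hN', map_one, one_mul]

/-- **AN ABELIAN SUBVARIETY IS THE IMAGE OF EXACTLY ONE IDEMPOTENT OF `End⁰ X` IF IT IS `End X`-STABLE, AND OF INFINITELY MANY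
OTHERWISE** (every abelian variety over a perfect field). [cite: LangeRodriguez2022, §2.9 (PDF p. 43)] [cite: Lam2001FirstCourse, §21 Lemma (21.5) p. 308 and §22 Prop. (22.1) p. 326]
[cite: MumfordAV1970, §19 Cor. 2 of Thm. 1 (p. 174)] -/
theorem setOf_isIdempotentElem_range_eq_subvariety_eq_singleton_or_infinite {Z : Motives.AbelianVariety K} (i : Z ⟶ X)
    [IsClosedImmersion (Hom.toSchemeHom i)] :
    ((∀ ψ : X ⟶ X, Set.range (Hom.toSchemeHom (i ≫ ψ)) ⊆ Set.range (Hom.toSchemeHom i)) ∧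
      ∃ z, {z' : X.endAlgebra | IsIdempotentElem z' ∧ ∃ (d' : ℕ) (u' : X ⟶ X), d' ≠ 0 ∧
        algebraMap ℚ X.endAlgebra (d' : ℚ) * z' = endAlgebra.of X (End.of u') ∧
          Set.range (Hom.toSchemeHom u') = Set.range (Hom.toSchemeHom i)} = {z}) ∨
    ((¬ ∀ ψ : X ⟶ X, Set.range (Hom.toSchemeHom (i ≫ ψ)) ⊆ Set.range (Hom.toSchemeHom i)) ∧
      {z' : X.endAlgebra | IsIdempotentElem z' ∧ ∃ (d' : ℕ) (u' : X ⟶ X), d' ≠ 0 ∧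
        algebraMap ℚ X.endAlgebra (d' : ℚ) * z' = endAlgebra.of X (End.of u') ∧
          Set.range (Hom.toSchemeHom u') = Set.range (Hom.toSchemeHom i)}.Infinite) := by
  obtain ⟨z, d, u, hzi, hd, hz, hrange⟩ := exists_isIdempotentElem_range_eq_subvariety i
  have hiff : (∀ ψ : X ⟶ X, Set.range (Hom.toSchemeHom (i ≫ ψ)) ⊆ Set.range (Hom.toSchemeHom i)) ↔
      ∀ ψ : X ⟶ X, Set.range (Hom.toSchemeHom (u ≫ ψ)) ⊆ Set.range (Hom.toSchemeHom u) := by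
    simp only [range_toSchemeHom_comp_eq_image, hrange]
  rw [hiff, ← hrange]
  by_cases hstab : ∀ ψ : X ⟶ X, Set.range (Hom.toSchemeHom (u ≫ ψ)) ⊆ Set.range (Hom.toSchemeHom u)
  · exact Or.inl ⟨hstab, z, (setOf_isIdempotentElem_range_eq_eq_singleton_iff hzi hd hz).2 hstab⟩
  · exact Or.inr ⟨hstab, (infinite_setOf_isIdempotentElem_range_eq_iff hzi hd hz).2 hstab⟩

end Perfect

end AbelianVariety

end Literature.AlgebraicGeometry.HodgeTheory

end
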